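import Summits.Ventures.DiscreteObjects.UnitDistance.ReductionTowerZMod9Search
import Mathlib.Combinatorics.Pigeonhole
import Mathlib.Tactic.IntervalCases
import HarnessLib

/-!
# Cioabă's lift conjecture holds at `(p, k) = (3, 1 → 2)` in the kernel: `α(G₂(3)) = 27 = 3² · α(G₁(3))`
(cell `pub-namedobj`, target (U), seat udg g20; part 2 of 2 on top of `ReductionTowerZMod9Search.lean`; companion of
`ReductionTowerIndependence.lean` and `UnitQuadranceF7IndepNum.lean`)

Framing (verbatim for the cell): lottery ticket; floor = certified bounds/negative ranges.

`G_k(p) = unitCircleGraph (ZMod (p^k))`.  Cioabă (PhD thesis, Queen's Univ. 2005, Thm 4.3.7 and the remark after it) proves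
`α(G_{k+1}(p)) ≥ p²·α(G_k(p))` and believes equality; seat udg g19 verified the first instance `α(G₂(3)) = 27 = 9·α(G₁(3))` with two exact
engines outside the kernel.  Here it becomes a KERNEL theorem.  §1: the `73` search pieces `chunk_i` — each evaluates, by `decide +kernel`, the
leaf predicate `leafOK` (part 1) on the `i`-th triple of origin-fibre patterns (≤ 6,070 search calls per piece, 134,433 in total; one evaluation of
that total size exceeds the farm's per-evaluation memory, cf. `FiniteFieldLowerBoundF19Piece*`) — and `allLeaves`.  §2: the upper bound
`α(G₂(3)) ≤ 27`: an independent `28`-set `S` has, by pigeonhole over the `9` residue fibres, `≥ 4` points in one fibre; translating one of them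
to the origin (translations are automorphisms) puts `0 ∈ S` and `≥ 3` further points of `S` into the origin fibre `3𝔽₃²`, whose codes form `F8`;
the pattern `P = S ∩ F8` is one of the `219` lists of `F8pats`, and its certificate with `noIndepBM_sound` bounds `#S < 28`.  Lower bound: the
`27` points of the full fibres over the diagonal of `𝔽₃²`.  Also `α(G₁(3)) = 3` (brute force over the `4`-subsets of `𝔽₃²`), whence
`indepNum_zmod9_eq_sq_mul_indepNum_zmod3`.  For ALL `k`, `α(G_k(3)) = 3^(2k−1)` follows on paper from Hoffman's bound being tight at `p = 3`
(`λ_min(G_k(3)) = −2·3^(k−1)`, degree `4·3^(k−1)`; checked numerically for `k ≤ 4`, udg g3's spectral theorem in general) — not formalised.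
Second engines: udg g19 (bitset branch-and-bound, grid CNF) and this seat's independent bitmask DFS (code/udg20/count_g23.py, 161,335 nodes).
Replication/verification only; nothing here is cited as new mathematics.
-/

namespace Summit.Ventures.DiscreteObjects.UnitDistance

open SimpleGraph Finset

/-! ## §1 The 73 search pieces -/

set_option maxHeartbeats 400000000 in
/-- piece 0 of 73 (kernel search over the corresponding triple of `F8pats`). -/ theorem chunk_0 : (F8chunks.getD 0 []).all leafOK = true := by decide +kernel
set_option maxHeartbeats 400000000 in
/-- piece 1 of 73 (kernel search over the corresponding triple of `F8pats`). -/ theorem chunk_1 : (F8chunks.getD 1 []).all leafOK = true := by decide +kernel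
set_option maxHeartbeats 400000000 in
/-- piece 2 of 73 (kernel search over the corresponding triple of `F8pats`). -/ theorem chunk_2 : (F8chunks.getD 2 []).all leafOK = true := by decide +kernel
set_option maxHeartbeats 400000000 in
/-- piece 3 of 73 (kernel search over the corresponding triple of `F8pats`). -/ theorem chunk_3 : (F8chunks.getD 3 []).all leafOK = true := by decide +kernel
set_option maxHeartbeats 400000000 in
/-- piece 4 of 73 (kernel search over the corresponding triple of `F8pats`). -/ theorem chunk_4 : (F8chunks.getD 4 []).all leafOK = true := by decide +kernel
set_option maxHeartbeats 400000000 in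
/-- piece 5 of 73 (kernel search over the corresponding triple of `F8pats`). -/ theorem chunk_5 : (F8chunks.getD 5 []).all leafOK = true := by decide +kernel
set_option maxHeartbeats 400000000 in
/-- piece 6 of 73 (kernel search over the corresponding triple of `F8pats`). -/ theorem chunk_6 : (F8chunks.getD 6 []).all leafOK = true := by decide +kernel
set_option maxHeartbeats 400000000 in
/-- piece 7 of 73 (kernel search over the corresponding triple of `F8pats`). -/ theorem chunk_7 : (F8chunks.getD 7 []).all leafOK = true := by decide +kernel
set_option maxHeartbeats 400000000 in
/-- piece 8 of 73 (kernel search over the corresponding triple of `F8pats`). -/ theorem chunk_8 : (F8chunks.getD 8 []).all leafOK = true := by decide +kernel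
set_option maxHeartbeats 400000000 in
/-- piece 9 of 73 (kernel search over the corresponding triple of `F8pats`). -/ theorem chunk_9 : (F8chunks.getD 9 []).all leafOK = true := by decide +kernel
set_option maxHeartbeats 400000000 in
/-- piece 10 of 73 (kernel search over the corresponding triple of `F8pats`). -/ theorem chunk_10 : (F8chunks.getD 10 []).all leafOK = true := by decide +kernel
set_option maxHeartbeats 400000000 in
/-- piece 11 of 73 (kernel search over the corresponding triple of `F8pats`). -/ theorem chunk_11 : (F8chunks.getD 11 []).all leafOK = true := by decide +kernel
set_option maxHeartbeats 400000000 in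
/-- piece 12 of 73 (kernel search over the corresponding triple of `F8pats`). -/ theorem chunk_12 : (F8chunks.getD 12 []).all leafOK = true := by decide +kernel
set_option maxHeartbeats 400000000 in
/-- piece 13 of 73 (kernel search over the corresponding triple of `F8pats`). -/ theorem chunk_13 : (F8chunks.getD 13 []).all leafOK = true := by decide +kernel
set_option maxHeartbeats 400000000 in
/-- piece 14 of 73 (kernel search over the corresponding triple of `F8pats`). -/ theorem chunk_14 : (F8chunks.getD 14 []).all leafOK = true := by decide +kernel
set_option maxHeartbeats 400000000 in
/-- piece 15 of 73 (kernel search over the corresponding triple of `F8pats`). -/ theorem chunk_15 : (F8chunks.getD 15 []).all leafOK = true := by decide +kernel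
set_option maxHeartbeats 400000000 in
/-- piece 16 of 73 (kernel search over the corresponding triple of `F8pats`). -/ theorem chunk_16 : (F8chunks.getD 16 []).all leafOK = true := by decide +kernel
set_option maxHeartbeats 400000000 in
/-- piece 17 of 73 (kernel search over the corresponding triple of `F8pats`). -/ theorem chunk_17 : (F8chunks.getD 17 []).all leafOK = true := by decide +kernel
set_option maxHeartbeats 400000000 in
/-- piece 18 of 73 (kernel search over the corresponding triple of `F8pats`). -/ theorem chunk_18 : (F8chunks.getD 18 []).all leafOK = true := by decide +kernel
set_option maxHeartbeats 400000000 in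
/-- piece 19 of 73 (kernel search over the corresponding triple of `F8pats`). -/ theorem chunk_19 : (F8chunks.getD 19 []).all leafOK = true := by decide +kernel
set_option maxHeartbeats 400000000 in
/-- piece 20 of 73 (kernel search over the corresponding triple of `F8pats`). -/ theorem chunk_20 : (F8chunks.getD 20 []).all leafOK = true := by decide +kernel
set_option maxHeartbeats 400000000 in
/-- piece 21 of 73 (kernel search over the corresponding triple of `F8pats`). -/ theorem chunk_21 : (F8chunks.getD 21 []).all leafOK = true := by decide +kernel
set_option maxHeartbeats 400000000 in
/-- piece 22 of 73 (kernel search over the corresponding triple of `F8pats`). -/ theorem chunk_22 : (F8chunks.getD 22 []).all leafOK = true := by decide +kernel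
set_option maxHeartbeats 400000000 in
/-- piece 23 of 73 (kernel search over the corresponding triple of `F8pats`). -/ theorem chunk_23 : (F8chunks.getD 23 []).all leafOK = true := by decide +kernel
set_option maxHeartbeats 400000000 in
/-- piece 24 of 73 (kernel search over the corresponding triple of `F8pats`). -/ theorem chunk_24 : (F8chunks.getD 24 []).all leafOK = true := by decide +kernel
set_option maxHeartbeats 400000000 in
/-- piece 25 of 73 (kernel search over the corresponding triple of `F8pats`). -/ theorem chunk_25 : (F8chunks.getD 25 []).all leafOK = true := by decide +kernel
set_option maxHeartbeats 400000000 in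
/-- piece 26 of 73 (kernel search over the corresponding triple of `F8pats`). -/ theorem chunk_26 : (F8chunks.getD 26 []).all leafOK = true := by decide +kernel
set_option maxHeartbeats 400000000 in
/-- piece 27 of 73 (kernel search over the corresponding triple of `F8pats`). -/ theorem chunk_27 : (F8chunks.getD 27 []).all leafOK = true := by decide +kernel
set_option maxHeartbeats 400000000 in
/-- piece 28 of 73 (kernel search over the corresponding triple of `F8pats`). -/ theorem chunk_28 : (F8chunks.getD 28 []).all leafOK = true := by decide +kernel
set_option maxHeartbeats 400000000 in
/-- piece 29 of 73 (kernel search over the corresponding triple of `F8pats`). -/ theorem chunk_29 : (F8chunks.getD 29 []).all leafOK = true := by decide +kernel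
set_option maxHeartbeats 400000000 in
/-- piece 30 of 73 (kernel search over the corresponding triple of `F8pats`). -/ theorem chunk_30 : (F8chunks.getD 30 []).all leafOK = true := by decide +kernel
set_option maxHeartbeats 400000000 in
/-- piece 31 of 73 (kernel search over the corresponding triple of `F8pats`). -/ theorem chunk_31 : (F8chunks.getD 31 []).all leafOK = true := by decide +kernel
set_option maxHeartbeats 400000000 in
/-- piece 32 of 73 (kernel search over the corresponding triple of `F8pats`). -/ theorem chunk_32 : (F8chunks.getD 32 []).all leafOK = true := by decide +kernel
set_option maxHeartbeats 400000000 in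
/-- piece 33 of 73 (kernel search over the corresponding triple of `F8pats`). -/ theorem chunk_33 : (F8chunks.getD 33 []).all leafOK = true := by decide +kernel
set_option maxHeartbeats 400000000 in
/-- piece 34 of 73 (kernel search over the corresponding triple of `F8pats`). -/ theorem chunk_34 : (F8chunks.getD 34 []).all leafOK = true := by decide +kernel
set_option maxHeartbeats 400000000 in
/-- piece 35 of 73 (kernel search over the corresponding triple of `F8pats`). -/ theorem chunk_35 : (F8chunks.getD 35 []).all leafOK = true := by decide +kernel
set_option maxHeartbeats 400000000 in
/-- piece 36 of 73 (kernel search over the corresponding triple of `F8pats`). -/ theorem chunk_36 : (F8chunks.getD 36 []).all leafOK = true := by decide +kernel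
set_option maxHeartbeats 400000000 in
/-- piece 37 of 73 (kernel search over the corresponding triple of `F8pats`). -/ theorem chunk_37 : (F8chunks.getD 37 []).all leafOK = true := by decide +kernel
set_option maxHeartbeats 400000000 in
/-- piece 38 of 73 (kernel search over the corresponding triple of `F8pats`). -/ theorem chunk_38 : (F8chunks.getD 38 []).all leafOK = true := by decide +kernel
set_option maxHeartbeats 400000000 in
/-- piece 39 of 73 (kernel search over the corresponding triple of `F8pats`). -/ theorem chunk_39 : (F8chunks.getD 39 []).all leafOK = true := by decide +kernel
set_option maxHeartbeats 400000000 in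
/-- piece 40 of 73 (kernel search over the corresponding triple of `F8pats`). -/ theorem chunk_40 : (F8chunks.getD 40 []).all leafOK = true := by decide +kernel
set_option maxHeartbeats 400000000 in
/-- piece 41 of 73 (kernel search over the corresponding triple of `F8pats`). -/ theorem chunk_41 : (F8chunks.getD 41 []).all leafOK = true := by decide +kernel
set_option maxHeartbeats 400000000 in
/-- piece 42 of 73 (kernel search over the corresponding triple of `F8pats`). -/ theorem chunk_42 : (F8chunks.getD 42 []).all leafOK = true := by decide +kernel
set_option maxHeartbeats 400000000 in
/-- piece 43 of 73 (kernel search over the corresponding triple of `F8pats`). -/ theorem chunk_43 : (F8chunks.getD 43 []).all leafOK = true := by decide +kernel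
set_option maxHeartbeats 400000000 in
/-- piece 44 of 73 (kernel search over the corresponding triple of `F8pats`). -/ theorem chunk_44 : (F8chunks.getD 44 []).all leafOK = true := by decide +kernel
set_option maxHeartbeats 400000000 in
/-- piece 45 of 73 (kernel search over the corresponding triple of `F8pats`). -/ theorem chunk_45 : (F8chunks.getD 45 []).all leafOK = true := by decide +kernel
set_option maxHeartbeats 400000000 in
/-- piece 46 of 73 (kernel search over the corresponding triple of `F8pats`). -/ theorem chunk_46 : (F8chunks.getD 46 []).all leafOK = true := by decide +kernel
set_option maxHeartbeats 400000000 in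
/-- piece 47 of 73 (kernel search over the corresponding triple of `F8pats`). -/ theorem chunk_47 : (F8chunks.getD 47 []).all leafOK = true := by decide +kernel
set_option maxHeartbeats 400000000 in
/-- piece 48 of 73 (kernel search over the corresponding triple of `F8pats`). -/ theorem chunk_48 : (F8chunks.getD 48 []).all leafOK = true := by decide +kernel
set_option maxHeartbeats 400000000 in
/-- piece 49 of 73 (kernel search over the corresponding triple of `F8pats`). -/ theorem chunk_49 : (F8chunks.getD 49 []).all leafOK = true := by decide +kernel
set_option maxHeartbeats 400000000 in
/-- piece 50 of 73 (kernel search over the corresponding triple of `F8pats`). -/ theorem chunk_50 : (F8chunks.getD 50 []).all leafOK = true := by decide +kernel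
set_option maxHeartbeats 400000000 in
/-- piece 51 of 73 (kernel search over the corresponding triple of `F8pats`). -/ theorem chunk_51 : (F8chunks.getD 51 []).all leafOK = true := by decide +kernel
set_option maxHeartbeats 400000000 in
/-- piece 52 of 73 (kernel search over the corresponding triple of `F8pats`). -/ theorem chunk_52 : (F8chunks.getD 52 []).all leafOK = true := by decide +kernel
set_option maxHeartbeats 400000000 in
/-- piece 53 of 73 (kernel search over the corresponding triple of `F8pats`). -/ theorem chunk_53 : (F8chunks.getD 53 []).all leafOK = true := by decide +kernel
set_option maxHeartbeats 400000000 in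
/-- piece 54 of 73 (kernel search over the corresponding triple of `F8pats`). -/ theorem chunk_54 : (F8chunks.getD 54 []).all leafOK = true := by decide +kernel
set_option maxHeartbeats 400000000 in
/-- piece 55 of 73 (kernel search over the corresponding triple of `F8pats`). -/ theorem chunk_55 : (F8chunks.getD 55 []).all leafOK = true := by decide +kernel
set_option maxHeartbeats 400000000 in
/-- piece 56 of 73 (kernel search over the corresponding triple of `F8pats`). -/ theorem chunk_56 : (F8chunks.getD 56 []).all leafOK = true := by decide +kernel
set_option maxHeartbeats 400000000 in
/-- piece 57 of 73 (kernel search over the corresponding triple of `F8pats`). -/ theorem chunk_57 : (F8chunks.getD 57 []).all leafOK = true := by decide +kernel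
set_option maxHeartbeats 400000000 in
/-- piece 58 of 73 (kernel search over the corresponding triple of `F8pats`). -/ theorem chunk_58 : (F8chunks.getD 58 []).all leafOK = true := by decide +kernel
set_option maxHeartbeats 400000000 in
/-- piece 59 of 73 (kernel search over the corresponding triple of `F8pats`). -/ theorem chunk_59 : (F8chunks.getD 59 []).all leafOK = true := by decide +kernel
set_option maxHeartbeats 400000000 in
/-- piece 60 of 73 (kernel search over the corresponding triple of `F8pats`). -/ theorem chunk_60 : (F8chunks.getD 60 []).all leafOK = true := by decide +kernel
set_option maxHeartbeats 400000000 in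
/-- piece 61 of 73 (kernel search over the corresponding triple of `F8pats`). -/ theorem chunk_61 : (F8chunks.getD 61 []).all leafOK = true := by decide +kernel
set_option maxHeartbeats 400000000 in
/-- piece 62 of 73 (kernel search over the corresponding triple of `F8pats`). -/ theorem chunk_62 : (F8chunks.getD 62 []).all leafOK = true := by decide +kernel
set_option maxHeartbeats 400000000 in
/-- piece 63 of 73 (kernel search over the corresponding triple of `F8pats`). -/ theorem chunk_63 : (F8chunks.getD 63 []).all leafOK = true := by decide +kernel
set_option maxHeartbeats 400000000 in
/-- piece 64 of 73 (kernel search over the corresponding triple of `F8pats`). -/ theorem chunk_64 : (F8chunks.getD 64 []).all leafOK = true := by decide +kernel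
set_option maxHeartbeats 400000000 in
/-- piece 65 of 73 (kernel search over the corresponding triple of `F8pats`). -/ theorem chunk_65 : (F8chunks.getD 65 []).all leafOK = true := by decide +kernel
set_option maxHeartbeats 400000000 in
/-- piece 66 of 73 (kernel search over the corresponding triple of `F8pats`). -/ theorem chunk_66 : (F8chunks.getD 66 []).all leafOK = true := by decide +kernel
set_option maxHeartbeats 400000000 in
/-- piece 67 of 73 (kernel search over the corresponding triple of `F8pats`). -/ theorem chunk_67 : (F8chunks.getD 67 []).all leafOK = true := by decide +kernel
set_option maxHeartbeats 400000000 in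
/-- piece 68 of 73 (kernel search over the corresponding triple of `F8pats`). -/ theorem chunk_68 : (F8chunks.getD 68 []).all leafOK = true := by decide +kernel
set_option maxHeartbeats 400000000 in
/-- piece 69 of 73 (kernel search over the corresponding triple of `F8pats`). -/ theorem chunk_69 : (F8chunks.getD 69 []).all leafOK = true := by decide +kernel
set_option maxHeartbeats 400000000 in
/-- piece 70 of 73 (kernel search over the corresponding triple of `F8pats`). -/ theorem chunk_70 : (F8chunks.getD 70 []).all leafOK = true := by decide +kernel
set_option maxHeartbeats 400000000 in
/-- piece 71 of 73 (kernel search over the corresponding triple of `F8pats`). -/ theorem chunk_71 : (F8chunks.getD 71 []).all leafOK = true := by decide +kernel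
set_option maxHeartbeats 400000000 in
/-- piece 72 of 73 (kernel search over the corresponding triple of `F8pats`). -/ theorem chunk_72 : (F8chunks.getD 72 []).all leafOK = true := by decide +kernel

/-- `F8chunks` has `73` entries. -/
theorem length_F8chunks : F8chunks.length = 73 := by decide +kernel

set_option maxRecDepth 100000 in
/-- Every chunk passes. -/
theorem chunks_all : ∀ (i : ℕ) (hi : i < F8chunks.length), (F8chunks[i]).all leafOK = true := by
  intro i hi
  rw [← List.getD_eq_getElem F8chunks [] hi]
  rw [length_F8chunks] at hi
  interval_cases i
  exacts [chunk_0, chunk_1, chunk_2, chunk_3, chunk_4, chunk_5, chunk_6, chunk_7, chunk_8, chunk_9, chunk_10, chunk_11, chunk_12, chunk_13, chunk_14, chunk_15, chunk_16, chunk_17, chunk_18, chunk_19, chunk_20, chunk_21, chunk_22, chunk_23, chunk_24, chunk_25, chunk_26, chunk_27, chunk_28, chunk_29, chunk_30, chunk_31, chunk_32, chunk_33, chunk_34, chunk_35, chunk_36, chunk_37, chunk_38, chunk_39, chunk_40, chunk_41, chunk_42, chunk_43, chunk_44, chunk_45, chunk_46, chunk_47, chunk_48, chunk_49, chunk_50,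 chunk_51, chunk_52, chunk_53, chunk_54, chunk_55, chunk_56, chunk_57, chunk_58, chunk_59, chunk_60, chunk_61, chunk_62, chunk_63, chunk_64, chunk_65, chunk_66, chunk_67, chunk_68, chunk_69, chunk_70, chunk_71, chunk_72]

/-- ALL LEAVES: every pattern of `F8pats` passes the leaf search. -/
theorem allLeaves : ∀ L ∈ F8pats, leafOK L = true := by
  intro L hL
  rw [← flatten_F8chunks, List.mem_flatten] at hL
  obtain ⟨c, hc, hLc⟩ := hL
  obtain ⟨i, hi, rfl⟩ := List.getElem_of_mem hc
  exact List.all_eq_true.1 (chunks_all i hi) L hLc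

/-! ## §2 The theorems -/

/-- UPPER BOUND: every independent set of `unitCircleGraph (ZMod 9)` has at most `27` elements. -/
theorem card_le_27_of_isIndepSet_zmod9 (S : Finset (ZMod 9 × ZMod 9))
    (hS : (unitCircleGraph (ZMod 9)).IsIndepSet (S : Set (ZMod 9 × ZMod 9))) : #S ≤ 27 := by
  classical
  by_contra hlt
  have h28 : 28 ≤ #S := by omega
  -- pigeonhole: some residue fibre carries at least 4 points of S
  obtain ⟨y, -, hy⟩ := Finset.exists_lt_card_fiber_of_mul_lt_card_of_maps_to
    (s := S) (t := (univ : Finset (ZMod 3 × ZMod 3))) (f := red9) (n := 3) (fun a _ => mem_univ _)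
    (by simp only [card_univ, Fintype.card_prod, ZMod.card]; omega)
  have hne : (S.filter fun a => red9 a = y).Nonempty := by
    rw [← card_pos]; omega
  obtain ⟨x, hx⟩ := hne
  rw [mem_filter] at hx
  -- translate x to the origin
  set S' : Finset (ZMod 9 × ZMod 9) := S.image fun v => v - x with hS'def
  have hS' : (unitCircleGraph (ZMod 9)).IsIndepSet (S' : Set (ZMod 9 × ZMod 9)) := isIndepSet_image_sub S x hS
  have hcardS' : #S' = #S := card_image_of_injective _ (sub_left_injective)
  have h0 : ((0, 0) : ZMod 9 × ZMod 9) ∈ S' := by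
    rw [hS'def, mem_image]; exact ⟨x, hx.1, by ext <;> simp⟩
  have hfib : 4 ≤ #(S'.filter fun a => red9 a = 0) := by
    have : (S.filter fun a => red9 a = y).image (fun v => v - x) ⊆ S'.filter fun a => red9 a = 0 := by
      intro a ha
      rw [mem_image] at ha
      obtain ⟨v, hv, rfl⟩ := ha
      rw [mem_filter] at hv ⊢
      refine ⟨mem_image_of_mem _ hv.1, ?_⟩
      rw [red9_sub, hv.2, hx.2, sub_self]
    have hc := card_le_card this
    rw [card_image_of_injective _ (sub_left_injective)] at hc
    omega
  -- code the vertices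
  set T : Finset ℕ := S'.image enc9 with hTdef
  have hcardT : #T = #S' := card_image_of_injective _ enc9_injective
  have hT0 : (0 : ℕ) ∈ T := by rw [hTdef, mem_image]; exact ⟨(0, 0), h0, by decide⟩
  have hTind : ∀ a ∈ T, ∀ b ∈ T, a ≠ b → ¬ (unitCircleGraph (ZMod 9)).Adj (dec9 a) (dec9 b) := by
    intro a ha b hb hab
    rw [hTdef, mem_image] at ha hb
    obtain ⟨v, hv, rfl⟩ := ha
    obtain ⟨w, hw, rfl⟩ := hb
    rw [dec9_enc9, dec9_enc9]
    have hvw : v ≠ w := fun e => hab (by rw [e])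
    exact hS' hv hw hvw
  have hTlt : ∀ a ∈ T, a < 81 := by
    intro a ha; rw [hTdef, mem_image] at ha; obtain ⟨v, -, rfl⟩ := ha; exact enc9_lt v
  -- the pattern in the origin fibre
  set P : Finset ℕ := T.filter fun a => a ∈ F8 with hPdef
  have hP : P ∈ F8.powerset := by
    rw [mem_powerset]; intro a ha; rw [hPdef, mem_filter] at ha; exact ha.2
  have hP3 : 3 ≤ #P := by
    have hsub : ((S'.filter fun a => red9 a = 0).erase (0, 0)).image enc9 ⊆ P := by
      intro a ha
      rw [mem_image] at ha
      obtain ⟨v, hv, rfl⟩ := ha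
      rw [mem_erase, mem_filter] at hv
      rw [hPdef, mem_filter]
      exact ⟨mem_image_of_mem _ hv.2.1, enc9_mem_F8_of_red9 v hv.2.2 hv.1⟩
    have hc := card_le_card hsub
    rw [card_image_of_injective _ enc9_injective, card_erase_of_mem (mem_filter.2 ⟨h0, by decide⟩)] at hc
    omega
  obtain ⟨L, hL, hLnd, hLP⟩ := exists_F8pats_of_subset P hP hP3
  have hleaf : leafOK L = true := allLeaves L hL
  -- the chosen set of the leaf state: the origin and the pattern
  have h0P : (0 : ℕ) ∉ P := by
    intro h; rw [hPdef, mem_filter] at h; exact (F8_facts 0 h.2).2 rfl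
  have hcardC : #(insert 0 P) = L.length + 1 := by
    rw [card_insert_of_notMem h0P, ← hLP, List.card_toFinset, List.Nodup.dedup hLnd]
  have hlt' : #T < 28 := by
    refine noIndepBM_sound tb2 meet2 tb2_meet2 coMask9 28 4 81 (fun i j => (unitCircleGraph (ZMod 9)).Adj (dec9 i) (dec9 j))
      coMask9_spec ud9Rest8 0 (insert 0 P) (leafMask L) ud9Rest8_nodup ?_ ?_ ?_ ?_ ?_ T ?_ ?_ hTind ?_
    · intro w hw; exact (ud9Rest8_facts w hw).1
    · intro u hu
      rcases mem_insert.1 hu with rfl | hu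
      · norm_num
      · rw [hPdef, mem_filter] at hu; exact (F8_facts u hu.2).1
    · intro w hw hwc
      rcases mem_insert.1 hwc with rfl | hwc
      · exact (ud9Rest8_facts 0 hw).2.1 rfl
      · rw [hPdef, mem_filter] at hwc; exact (ud9Rest8_facts w hw).2.2 hwc.2
    · intro w hw hcomp
      have hw81 := (ud9Rest8_facts w hw).1
      refine tb2_leafMask L w ?_ ?_
      · exact coMask9_spec 0 w (by norm_num) hw81 (fun e => (ud9Rest8_facts w hw).2.1 e.symm) (hcomp 0 (mem_insert_self _ _))
      · intro v hv
        have hvP : v ∈ P := by rw [← hLP, List.mem_toFinset]; exact hv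
        have hvF : v ∈ F8 := by rw [hPdef, mem_filter] at hvP; exact hvP.2
        exact coMask9_spec v w (F8_facts v hvF).1 hw81 (fun e => (ud9Rest8_facts w hw).2.2 (e ▸ hvF))
          (hcomp v (mem_insert_of_mem hvP))
    · rw [hcardC]; unfold leafOK at hleaf; exact hleaf
    · intro a ha
      rcases mem_insert.1 ha with rfl | ha
      · exact hT0
      · rw [hPdef, mem_filter] at ha; exact ha.1
    · intro a ha
      by_cases ha0 : a = 0
      · exact Or.inl (by rw [ha0]; exact mem_insert_self _ _)
      · rcases mem_F8_or_rest8 ⟨a, hTlt a ha⟩ ha0 with hF | hR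
        · exact Or.inl (mem_insert_of_mem (by rw [hPdef, mem_filter]; exact ⟨ha, hF⟩))
        · exact Or.inr hR
    · have h3 : 3 ≤ L.length := by
        have h := hP3
        rw [← hLP, List.card_toFinset, List.Nodup.dedup hLnd] at h
        exact h
      have h0' : #(T.filter fun x => x ∈ ud9Rest8.take 0) = 0 := by simp
      rw [hcardC, h0']
      omega
  omega

/-- LOWER BOUND: the full fibres over the diagonal of `𝔽₃²` — an explicit independent `27`-set. -/
def indep27Zmod9 : Finset (ZMod 9 × ZMod 9) :=
  {(0, 0), (0, 3), (0, 6), (1, 1), (1, 4), (1, 7), (2, 2), (2, 5), (2, 8), (3, 0), (3, 3), (3, 6), (4, 1), (4, 4), (4, 7),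
   (5, 2), (5, 5), (5, 8), (6, 0), (6, 3), (6, 6), (7, 1), (7, 4), (7, 7), (8, 2), (8, 5), (8, 8)}

/-- It is an independent `27`-set. -/
theorem isNIndepSet_indep27Zmod9 : (unitCircleGraph (ZMod 9)).IsNIndepSet 27 indep27Zmod9 :=
  ⟨by rw [isIndepSet_iff]; unfold indep27Zmod9 unitCircleGraph; decide, rfl⟩

/-- `α(G₂(3)) = α(unitCircleGraph (ZMod 9)) = 27`. -/
theorem indepNum_unitCircleGraph_zmod9 : (unitCircleGraph (ZMod 9)).indepNum = 27 := by
  classical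
  apply le_antisymm
  · obtain ⟨s, hs⟩ := (unitCircleGraph (ZMod 9)).exists_isNIndepSet_indepNum
    rw [← hs.card_eq]
    exact card_le_27_of_isIndepSet_zmod9 s hs.isIndepSet
  · simpa [isNIndepSet_indep27Zmod9.card_eq] using isNIndepSet_indep27Zmod9.isIndepSet.card_le_indepNum

/-- The diagonal of `𝔽₃²`: an independent `3`-set of `G₁(3) = C₃ □ C₃`. -/
def indep3Zmod3 : Finset (ZMod 3 × ZMod 3) := {(0, 0), (1, 1), (2, 2)}

/-- It is an independent `3`-set. -/
theorem isNIndepSet_indep3Zmod3 : (unitCircleGraph (ZMod 3)).IsNIndepSet 3 indep3Zmod3 :=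
  ⟨by rw [isIndepSet_iff]; unfold indep3Zmod3 unitCircleGraph; decide, rfl⟩

set_option maxRecDepth 20000 in
/-- In `G₁(3)` every `4`-set spans an edge (brute force over the `126` subsets). -/
theorem not_isIndepSet_of_card_four_zmod3 : ∀ S : Finset (ZMod 3 × ZMod 3), #S = 4 →
    ¬ (unitCircleGraph (ZMod 3)).IsIndepSet (S : Set (ZMod 3 × ZMod 3)) := by
  intro S hS hind
  rw [isIndepSet_iff] at hind
  revert S
  unfold unitCircleGraph
  decide

/-- `α(G₁(3)) = α(unitCircleGraph (ZMod 3)) = 3`. -/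
theorem indepNum_unitCircleGraph_zmod3 : (unitCircleGraph (ZMod 3)).indepNum = 3 := by
  classical
  apply le_antisymm
  · obtain ⟨s, hs⟩ := (unitCircleGraph (ZMod 3)).exists_isNIndepSet_indepNum
    rw [← hs.card_eq]
    by_contra hlt
    obtain ⟨u, hu, hcu⟩ := exists_subset_card_eq (show 4 ≤ #s by omega)
    exact not_isIndepSet_of_card_four_zmod3 u hcu (hs.isIndepSet.mono (by exact_mod_cast hu))
  · simpa [isNIndepSet_indep3Zmod3.card_eq] using isNIndepSet_indep3Zmod3.isIndepSet.card_le_indepNum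

/-- CIOABĂ'S LIFT IDENTITY AT `(p, k) = (3, 1 → 2)`, KERNEL: `α(G₂(3)) = 3² · α(G₁(3))` (`27 = 9 · 3`). -/
theorem indepNum_zmod9_eq_sq_mul_indepNum_zmod3 :
    (unitCircleGraph (ZMod (3 ^ 2))).indepNum = 3 ^ 2 * (unitCircleGraph (ZMod (3 ^ 1))).indepNum := by
  have h9 : (unitCircleGraph (ZMod (3 ^ 2))).indepNum = 27 := indepNum_unitCircleGraph_zmod9
  have h3 : (unitCircleGraph (ZMod (3 ^ 1))).indepNum = 3 := indepNum_unitCircleGraph_zmod3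
  rw [h9, h3]; norm_num

end Summit.Ventures.DiscreteObjects.UnitDistance
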